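import Literature.Computability.MetaComplexity.RandomCNFResolution
import Literature.Computability.MetaComplexity.ResolutionSizeWidth
import Literature.Computability.MetaComplexity.ResolutionExpansionWidth
import Literature.Computability.MetaComplexity.RandomCNFFirstMoment
import HarnessLib

/-!
# Proof of the Chvátal–Szemerédi theorem (`chvatal_szemeredi_holds`)

DISCHARGE of the named fact `chvatal_szemeredi` (`RandomCNFResolution.lean`; Chvátal–Szemerédi
1988, Theorem of §1 / abstract): for `k ≥ 3` and a natural clause density `c ≥ 0.7 · 2^k` there
is `ε > 0` such that, with probability `→ 1`, `φ ∼ F_k(n, cn)` is unsatisfiable and every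
resolution refutation of `φ` has at least `(1+ε)^n` lines.

The proof is the Ben-Sasson–Wigderson width route (Ben-Sasson–Wigderson 2001, §§3, 5, 6), all
of whose ingredients are proved in the tree:

1. `card_le_of_forall_satisfiable` (`RandomCNFFirstMoment`): the formula is satisfiable with
   probability `≤ (2 (1 - 2^{-k})^c)^n`, and `2 (1 - 2^{-k})^c ≤ 2 e^{-0.7} < 1` by
   `log 2 < 0.7` (`Real.log_two_lt_d9`);
2. `card_le_of_forall_not_isCoverExpander_linear` (ibid.): with `a = (2k+1)/4`, `B = e^{1+a} c a`,
   `κ = 1/(a (2B)^4)`, the scope family is an `(⌊κn⌋, a)`-cover expander except with probability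
   `≤ 32 a B^4 / n`; cover expansion `(k + 1/2)/2` gives boundary expansion `1/2`
   (`IsCoverExpander.isBoundaryExpander`, `ScopeExpansion`);
3. `not_resDerivable_empty_of_isBoundaryExpander` (`ResolutionExpansionWidth`, BSW Thm 4.15/6.5):
   no refutation of width `< ⌊κn⌋/4`;
4. `exp_le_length_of_not_derivable` (`ResolutionSizeWidth`, BSW Thm 3.5 / Cor 3.6): every
   refutation has `≥ exp(q²/2n)` lines, `q = ⌊⌊κn⌋/16⌋ ≥ κn/32`, i.e. `≥ (1+ε)^n` with
   `1 + ε = exp(κ²/2048)`;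
5. the probability glue `randomKCNF_toOuterMeasure_ge` (`RandomScopes`) and a squeeze in `ℝ≥0∞`.

* `exp_le_length_of_isCoverExpander` — the deterministic core (2 ⇒ 3 ⇒ 4) for a tuple of
  `k`-clauses;
* `chvatal_szemeredi_holds` — the discharge.

## References

* V. Chvátal, E. Szemerédi, *Many hard examples for resolution*, J. ACM 35 (1988) 759–768,
  Theorem (§1 / abstract).
* E. Ben-Sasson, A. Wigderson, *Short proofs are narrow — resolution made simple*, J. ACM 48
  (2001) 149–169, Thm 3.5, Cor 3.6, Thm 4.15, §6.3.
-/

noncomputable section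

open Finset Filter Literature.Computability.Complexity
open scoped _root_.Topology ENNReal

namespace Literature.Computability.MetaComplexity

/-! ### Clauses of `kClauses k n` as set-clauses -/

/-- A `k`-clause over `n` variables has exactly `k` literals. [folklore] -/
theorem length_of_mem_kClauses {k n : ℕ} {x : Clause ℕ} (hx : x ∈ kClauses k n) :
    x.length = k := by
  obtain ⟨S, hS, ε, rfl⟩ := exists_eq_clauseOf_of_mem_kClauses hx
  simp [clauseOf, hS]

/-- The variables of the set-clause of a list clause are its scope. [folklore] -/
theorem clauseVars_toFinset (C : Clause ℕ) : clauseVars C.toFinset = clauseScope C := by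
  ext x
  rw [mem_clauseVars_iff, mem_clauseScope]
  constructor
  · rintro ⟨l, hl, rfl⟩
    exact ⟨l.2, by simpa using hl⟩
  · rintro ⟨b, hb⟩
    exact ⟨(x, b), List.mem_toFinset.2 hb, rfl⟩

/-- The axiom set of the listed formula of a clause tuple is the range of its set-clauses.
[folklore] -/
theorem clauseSet_ofFn {m : ℕ} (g : Fin m → Clause ℕ) :
    clauseSet (List.ofFn g) = Set.range fun i => (g i).toFinset := by
  ext C
  rw [mem_clauseSet_iff, Set.mem_range]
  constructor
  · rintro ⟨c, hc, rfl⟩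
    obtain ⟨i, rfl⟩ := List.mem_ofFn.1 hc
    exact ⟨i, rfl⟩
  · rintro ⟨i, rfl⟩
    exact ⟨g i, List.mem_ofFn.2 ⟨i, rfl⟩, rfl⟩

/-! ### The deterministic core -/

/-- **Expansion ⇒ exponential refutation size** (BSW Thm 4.15/6.5 + Thm 3.5, for a tuple of
`k`-clauses over `n` variables). If the scope family of `f : Fin m → kClauses k n` is an
`(N, (2k+1)/4)`-cover expander with `8k + 9 ≤ N ≤ n`, then every resolution refutation of the
listed formula has at least `exp(⌊N/16⌋² / 2n)` lines: cover expansion `(k + 1/2)/2` is boundary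
expansion `1/2`, which forbids refutations of width `2⌊N/16⌋ + k < N/4`, and the size–width
relation with `d = a = ⌊N/16⌋` does the rest.
[Ben-Sasson–Wigderson 2001, Cor. 3.6 with Thm 4.15] [cite: BenSassonWigderson2001, Cor. 3.6] -/
theorem exp_le_length_of_isCoverExpander {k n m N : ℕ} (f : Fin m → ↥(kClauses k n))
    (hexp : IsCoverExpander (fun i => clauseScope (f i : Clause ℕ)) N ((2 * k + 1 : ℝ) / 4))
    (hN : 8 * k + 9 ≤ N) (hNn : N ≤ n) {π : List (ResLine ℕ)}
    (hπ : IsResRefutation (List.ofFn fun i => (f i : Clause ℕ)) π) :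
    Real.exp (((N / 16 : ℕ) : ℝ) ^ 2 / (2 * n)) ≤ π.length := by
  classical
  set q : ℕ := N / 16 with hq
  set A : Fin m → Finset (Literal ℕ) := fun i => ((f i : Clause ℕ)).toFinset with hA
  -- boundary expansion `1/2` of the scope family `clauseVars ∘ A`
  have hfam : (fun i => clauseScope (f i : Clause ℕ)) = fun i => clauseVars (A i) := by
    funext i
    rw [hA, clauseVars_toFinset]
  have hpar : ((2 * k + 1 : ℝ) / 4) = ((k : ℝ) + 1 / 2) / 2 := by ring
  rw [hfam, hpar] at hexp
  have hbd : IsBoundaryExpander (fun i => clauseVars (A i)) N (1 / 2) :=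
    hexp.isBoundaryExpander fun i => by
      rw [← congrFun hfam i, card_clauseScope_of_mem_kClauses (f i).2]
  -- no refutation of width `2q + k < N/4`
  have hqN : ((q : ℕ) : ℝ) ≤ N / 16 := by rw [hq]; exact Nat.cast_div_le
  have hN' : (8 * k + 9 : ℝ) ≤ N := by exact_mod_cast hN
  have hw : ((q + q + k : ℕ) : ℝ) < 1 / 2 * N / 2 := by
    push_cast
    linarith
  have hnd : ¬ ResDerivable (clauseSet (List.ofFn fun i => (f i : Clause ℕ))) (q + q + k) ∅ := by
    rw [clauseSet_ofFn]
    exact not_resDerivable_empty_of_isBoundaryExpander hbd (by norm_num) (by linarith) hw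
  -- size–width
  have hφV : ∀ c ∈ (List.ofFn fun i => (f i : Clause ℕ)), ∀ l ∈ c, l.1 ∈ Finset.range n := by
    intro c hc l hl
    obtain ⟨i, rfl⟩ := List.mem_ofFn.1 hc
    exact clauseScope_subset_range (f i).2 (mem_clauseScope.2 ⟨l.2, hl⟩)
  have hk' : ∀ D ∈ clauseSet (List.ofFn fun i => (f i : Clause ℕ)), D.card ≤ k := by
    intro D hD
    obtain ⟨c, hc, rfl⟩ := mem_clauseSet_iff.1 hD
    obtain ⟨i, rfl⟩ := List.mem_ofFn.1 hc
    exact (List.toFinset_card_le _).trans (length_of_mem_kClauses (f i).2).le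
  have hd : q ≤ 2 * (Finset.range n).card := by
    rw [Finset.card_range]
    have : q ≤ N := Nat.div_le_self _ _
    omega
  have h := exp_le_length_of_not_derivable hπ (Finset.range n) hφV hk' q hd hnd
  rw [Finset.card_range] at h
  convert h using 2
  ring

/-! ### The discharge -/

/-- `2 (1 - 2^{-k})^c < 1` for `c ≥ 0.7 · 2^k`: `(1 - 2^{-k})^c ≤ e^{-c 2^{-k}} ≤ e^{-0.7}` and
`e^{0.7} > 2` because `log 2 < 0.6931471808 < 0.7`. [Chvátal–Szemerédi 1988, §1 (the density
threshold `c 2^{-k} ≥ 0.7 > ln 2`)] [folklore] -/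
theorem two_mul_pow_lt_one_of_density {k c : ℕ} (hc : (0.7 : ℝ) * 2 ^ k ≤ c) :
    2 * (1 - (1 / 2 : ℝ) ^ k) ^ c < 1 := by
  have h2k : (0 : ℝ) < 2 ^ k := by positivity
  have hx : (1 - (1 / 2 : ℝ) ^ k) ^ c ≤ Real.exp (-(c / 2 ^ k)) := by
    have h0 : (0 : ℝ) ≤ 1 - (1 / 2) ^ k := by
      rw [sub_nonneg]
      exact pow_le_one₀ (by norm_num) (by norm_num)
    calc (1 - (1 / 2 : ℝ) ^ k) ^ c ≤ (Real.exp (-(1 / 2) ^ k)) ^ c :=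
          pow_le_pow_left₀ h0 (Real.one_sub_le_exp_neg _) c
      _ = Real.exp (-(c / 2 ^ k)) := by
          rw [← Real.exp_nat_mul]
          congr 1
          rw [one_div_pow]
          ring
  have hc' : (0.7 : ℝ) ≤ c / 2 ^ k := by
    rw [le_div_iff₀ h2k]
    exact hc
  have hexp : Real.exp (-(c / 2 ^ k : ℝ)) ≤ Real.exp (-0.7) := Real.exp_le_exp.2 (by linarith)
  have h07 : Real.exp (-0.7) < 1 / 2 := by
    have h2 : (2 : ℝ) < Real.exp 0.7 := by
      rw [← Real.log_lt_iff_lt_exp (by norm_num)]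
      have := Real.log_two_lt_d9
      linarith
    rw [Real.exp_neg, inv_eq_one_div, div_lt_div_iff_of_pos_left (by norm_num) (Real.exp_pos _)
      (by norm_num)]
    exact h2
  linarith

/-- **Chvátal–Szemerédi 1988, Theorem — proved.** The named fact `chvatal_szemeredi` holds: for
`k ≥ 3` and a natural density `c` with `0.7 · 2^k ≤ c` there is `ε > 0` (here
`1 + ε = exp(κ²/2048)`, `κ = 1/(a (2B)^4)`, `a = (2k+1)/4`, `B = e^{1+a} c a`) such that
`Pr_{φ ∼ F_k(n, cn)}[φ unsatisfiable ∧ every resolution refutation has ≥ (1+ε)^n lines] → 1`.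
Proof: Ben-Sasson–Wigderson's width method — first-moment unsatisfiability and fixed-radius
expansion (`RandomCNFFirstMoment`), expansion ⇒ width (`ResolutionExpansionWidth`), width ⇒ size
(`ResolutionSizeWidth`). [Chvátal–Szemerédi 1988, Theorem (§1); Ben-Sasson–Wigderson 2001, §6]
[cite: ChvatalSzemeredi1988, Theorem (§1)] -/
theorem chvatal_szemeredi_holds : chvatal_szemeredi := by
  intro k c hk hc
  classical
  -- constants
  set a : ℝ := (2 * k + 1) / 4 with ha
  set B : ℝ := Real.exp (1 + a) * c * a with hB
  set κ : ℝ := 1 / (a * (2 * B) ^ 4) with hκ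
  set r : ℝ := 2 * (1 - (1 / 2 : ℝ) ^ k) ^ c with hr
  have hk3 : (3 : ℝ) ≤ k := by exact_mod_cast hk
  have hk1 : 1 ≤ k := by omega
  have hc1 : 1 ≤ c := by
    have h1 : (1 : ℝ) ≤ 2 ^ k := one_le_pow₀ (by norm_num)
    have h2 : (0 : ℝ) < c := by linarith
    exact_mod_cast h2
  have hc1' : (1 : ℝ) ≤ c := by exact_mod_cast hc1
  have ha74 : (7 : ℝ) / 4 ≤ a := by rw [ha]; linarith
  have hapos : 0 < a := by linarith
  have hBpos : 0 < B := by rw [hB]; positivity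
  have h2B : (1 : ℝ) ≤ 2 * B := by
    rw [hB]
    have h1 : (1 : ℝ) ≤ Real.exp (1 + a) := Real.one_le_exp (by linarith)
    nlinarith [mul_le_mul h1 hc1' (by norm_num) (by linarith : (0 : ℝ) ≤ Real.exp (1 + a))]
  have h2B4 : (1 : ℝ) ≤ (2 * B) ^ 4 := one_le_pow₀ h2B
  have hκpos : 0 < κ := by rw [hκ]; positivity
  have hκ1 : κ ≤ 1 := by
    rw [hκ, div_le_one (by positivity)]
    nlinarith
  have hr0 : 0 ≤ r := by
    rw [hr]
    have : (0 : ℝ) ≤ 1 - (1 / 2) ^ k := by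
      rw [sub_nonneg]; exact pow_le_one₀ (by norm_num) (by norm_num)
    positivity
  have hr1 : r < 1 := two_mul_pow_lt_one_of_density hc
  -- the rate
  refine ⟨Real.exp (κ ^ 2 / 2048) - 1, by linarith [Real.one_lt_exp_iff.2 (by positivity :
    (0 : ℝ) < κ ^ 2 / 2048)], ?_⟩
  have hε : 1 + (Real.exp (κ ^ 2 / 2048) - 1) = Real.exp (κ ^ 2 / 2048) := by ring
  -- the failure probability bound `β n = r^n + 32 a B^4 / n → 0`
  set β : ℕ → ℝ := fun n => r ^ n + 32 * a * B ^ 4 / n with hβ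
  have hβ0 : ∀ n, 0 ≤ β n := fun n => by rw [hβ]; positivity
  have hβlim : Tendsto β atTop (𝓝 0) := by
    have h1 := tendsto_pow_atTop_nhds_zero_of_lt_one hr0 hr1
    have h2 := tendsto_const_div_atTop_nhds_zero_nat (32 * a * B ^ 4)
    simpa using h1.add h2
  -- eventually, the hard event has mass `≥ 1 - β n`
  have hev : ∀ᶠ n : ℕ in atTop, 1 - ENNReal.ofReal (β n) ≤
      (randomKCNF k n (c * n)).toOuterMeasure (hardForResolution (Real.exp (κ ^ 2 / 2048) - 1) n) := by
    refine eventually_atTop.2 ⟨⌈(8 * k + 10) / κ⌉₊, fun n hn => ?_⟩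
    -- thresholds
    have hκn : (8 * k + 10 : ℝ) ≤ κ * n := by
      have h1 : (8 * k + 10 : ℝ) / κ ≤ n := (Nat.le_ceil _).trans (by exact_mod_cast hn)
      rw [div_le_iff₀ hκpos] at h1
      linarith
    set N : ℕ := ⌊κ * n⌋₊ with hNdef
    have hNle : (N : ℝ) ≤ κ * n := Nat.floor_le (by positivity)
    have hNge : κ * n - 1 < N := Nat.sub_one_lt_floor _
    have hN9 : 8 * k + 9 ≤ N := by
      have : (8 * k + 9 : ℝ) < N := by linarith
      exact_mod_cast this.le
    have hnpos : (0 : ℝ) < n := by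
      have : (0 : ℝ) < κ * n := by linarith
      exact pos_of_mul_pos_right this hκpos.le  -- hmm
    have hn1 : 1 ≤ n := by exact_mod_cast hnpos
    have hNn : N ≤ n := by
      have : (N : ℝ) ≤ n := hNle.trans (by nlinarith)
      exact_mod_cast this
    have hkn : k ≤ n := by
      have : (k : ℝ) ≤ N := by linarith
      have : k ≤ N := by exact_mod_cast this
      omega
    have hK : (kClauses k n).Nonempty := by
      rw [← Finset.card_pos, card_kClauses]
      exact Nat.mul_pos (Nat.choose_pos hkn) (by positivity)
    -- the expansion radius condition `a N ≤ n / (2B)^4`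
    have haN : a * N ≤ n / (2 * B) ^ 4 := by
      calc a * N ≤ a * (κ * n) := mul_le_mul_of_nonneg_left hNle hapos.le
        _ = n / (2 * B) ^ 4 := by rw [hκ]; field_simp
    -- the bad tuples
    set badS : Finset (Fin (c * n) → ↥(kClauses k n)) :=
      univ.filter fun g => CNF.Satisfiable (List.ofFn fun i => (g i : Clause ℕ)) with hbadS
    set badE : Finset (Fin (c * n) → ↥(kClauses k n)) :=
      univ.filter fun g => ¬ IsCoverExpander (fun i => clauseScope (g i : Clause ℕ)) N a
      with hbadE
    refine randomKCNF_toOuterMeasure_ge hK (hβ0 n) (badS ∪ badE) (fun g hg => ?_) ?_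
    · -- good tuples are hard
      rw [Finset.mem_union, not_or] at hg
      have hns : ¬ CNF.Satisfiable (List.ofFn fun i => (g i : Clause ℕ)) := fun h =>
        hg.1 (mem_filter.2 ⟨mem_univ _, h⟩)
      have hexp : IsCoverExpander (fun i => clauseScope (g i : Clause ℕ)) N a := by
        by_contra h
        exact hg.2 (mem_filter.2 ⟨mem_univ _, h⟩)
      refine ⟨hns, fun π hπ => ?_⟩
      have hlen := exp_le_length_of_isCoverExpander g (by rw [ha] at hexp; exact_mod_cast hexp)
        hN9 hNn hπ
      refine le_trans ?_ hlen
      rw [hε, ← Real.exp_nat_mul, Real.exp_le_exp]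
      -- `n κ² / 2048 ≤ q² / 2n` with `q = ⌊N/16⌋ ≥ κ n / 32`
      set q : ℕ := N / 16 with hq
      have hq1 : (N : ℝ) < (q : ℝ) * 16 + 16 := by
        have := Nat.lt_div_mul_add (a := N) (b := 16) (by norm_num)
        exact_mod_cast this
      have hq2 : κ * n / 32 ≤ q := by linarith
      have hq0 : 0 ≤ κ * n / 32 := by positivity
      rw [le_div_iff₀ (by positivity)]
      nlinarith [mul_le_mul hq2 hq2 hq0 (Nat.cast_nonneg q)]
    · -- the count
      have hS := card_le_of_forall_satisfiable badS (fun g hg => (mem_filter.1 hg).2)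
      have hE := card_le_of_forall_not_isCoverExpander_linear hk hc1 hn1 hK ha hB haN badE
        (fun g hg => (mem_filter.1 hg).2)
      have hKc : ((kClauses k n).card : ℝ) = (n.choose k : ℝ) * 2 ^ k := by
        rw [card_kClauses]; push_cast; ring
      have hSr : (badS.card : ℝ) ≤ r ^ n * ((((kClauses k n).card ^ (c * n) : ℕ)) : ℝ) := by
        have h1 : (badS.card : ℝ) ≤ 2 ^ n * ((n.choose k : ℝ) * (2 ^ k - 1)) ^ (c * n) := by
          have h2k : 1 ≤ 2 ^ k := Nat.one_le_two_pow
          exact_mod_cast hS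
        refine h1.trans (le_of_eq ?_)
        have h22 : (1 / 2 : ℝ) ^ k * 2 ^ k = 1 := by rw [← mul_pow]; norm_num
        have hbase : ((n.choose k : ℝ) * (2 ^ k - 1)) =
            (1 - (1 / 2) ^ k) * ((n.choose k : ℝ) * 2 ^ k) := by
          linear_combination (n.choose k : ℝ) * h22
        push_cast
        rw [hKc, hbase, mul_pow, pow_mul, hr]
        ring
      calc (((badS ∪ badE).card : ℕ) : ℝ) ≤ badS.card + badE.card := by
            exact_mod_cast Finset.card_union_le _ _
        _ ≤ r ^ n * ((((kClauses k n).card ^ (c * n) : ℕ)) : ℝ) +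
            32 * a * B ^ 4 / n * ((((kClauses k n).card ^ (c * n) : ℕ)) : ℝ) := add_le_add hSr hE
        _ = β n * ((((kClauses k n).card ^ (c * n) : ℕ)) : ℝ) := by rw [hβ]; ring
  -- squeeze
  have hβE : Tendsto (fun n => ENNReal.ofReal (β n)) atTop (𝓝 0) := by
    have := ENNReal.tendsto_ofReal hβlim
    rwa [ENNReal.ofReal_zero] at this
  have hlow : Tendsto (fun n => 1 - ENNReal.ofReal (β n)) atTop (𝓝 1) := by
    have := ENNReal.Tendsto.sub (tendsto_const_nhds (x := (1 : ℝ≥0∞))) hβE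
      (Or.inl ENNReal.one_ne_top)
    rwa [tsub_zero] at this
  refine tendsto_of_tendsto_of_tendsto_of_le_of_le' hlow tendsto_const_nhds hev
    (Eventually.of_forall fun n => ?_)
  exact (MeasureTheory.measure_mono (Set.subset_univ _)).trans_eq
    ((PMF.toOuterMeasure_apply_eq_one_iff _ _).2 (Set.subset_univ _))

end Literature.Computability.MetaComplexity
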